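import Summits.CriticalPhenomena.PercolationContinuityZ3.Theorems.PercNearOneGluingNoHeavyLowerTailTformStarPacking
import HarnessLib

/-!
# `NoHeavyLowerTail` (stmt-CriticalPhenomena-4575) — typed reduction of the crux to LIGHT-STAR PACKING (LSP, alias TCS⁺),
# one observer-free inequality in one graph

Support file (prover `prim-hp-5`, hull-port cell, T-form calculus, gen 3; `--supports stmt-CriticalPhenomena-4575`).
No definitions, no named facts, no sorries.  `μ = prodBernoulli u` on `Fin n`, relays `A`, level `j`, `π(x) = {a ∈ A : x ↔ a}`,
`π(B) = ⋃_{y ∈ B} π(y)`, `Φ(x) = μ{|π(x)| ≤ j}`, champion `q` (`Φ(a) ≤ Φ(q)` for all `a ∈ A`).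

**LSP (light-star packing; hypothesis `hLSP` below).**  For every weighted graph, `A`, `j`, champion `q ∈ A`, relay `c ∈ A`, and
nonempty set `B` of NON-relay vertices:
    `μ(q ≁ B, 1 ≤ |π(B)| ≤ j) + μ(|π(B)| = 0, |π(c)| ≤ j) ≤ μ(q ≁ B, |π(q)| ≤ j)`.
For `c = q` this is the guarded champion stability TCS at the glued set `B` (ttrl census `run/shared/lean/ttrl/tcs/README.md`,
0 / 40.9 M exhaustive pairs `n ≤ 7` + 96 000 climbs); in general it asks the TCS slack `σ_T(B, q)` to dominate
`μ(|π(B)| = 0, c light) − μ(|π(B)| = 0, q light)` for every relay `c` ("TCS⁺").  For `|B| = 1` it is the deficit form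
`slack_y(c) ≥ Φ(c) − Φ(q)` of the attached-champion inequality XZ at the non-relay observer `y`.  Census of this seat (exact
partition law, `lab/lsp_test.py`, `lab/pst_champ.py`): 0 violations / 34 765 (q, c, B) triples, `n ≤ 7`, `|B| ≤ 3`, + 0 / 2 656
light stars of random observers; stars with a relay member are a theorem (`CutObserver.unguardedStability_of_member`).

* `attachedChampion_of_lightStarPacking` — **LSP ⇒ the registered stub `stub_attachedChampion` verbatim** (XZ at every champion,
  every observer, every finite weighted graph, every level): apply `Theorems.tform_of_starPacking` at `o` with `p` = a champion of
  `K = G − o` and `c = q` the champion of `G` — `Φ_K(q) ≤ Φ_K(p)` and `Φ_G(p) ≤ Φ_G(q)` are automatic, relay stars are the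
  theorem, all-non-relay stars are LSP in `K`.
* `noHeavyLowerTail_of_lightStarPacking` — **LSP ⇒ `NoHeavyLowerTail`** (`Theorems.noHeavyLowerTail_of_attachedChampion`).
So the crux is reduced to ONE inequality with NO observer, NO gluing parameter and NO near-one hypothesis; its `|B| = 1`, `c = q`
instance is XZ itself one vertex-deletion down (an inductive strengthening), and its all-`c` form is what makes the induction close.
-/

noncomputable section

namespace Summit.CriticalPhenomena.PercolationContinuityZ3.Theorems

open MeasureTheory Set Literature.Probability.LatticeModels Literature.Probability.Percolation
open scoped Classical BigOperators

open CutObserver in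
/-- **LIGHT-STAR PACKING implies the attached-champion inequality (XZ) for every observer.**  Hypothesis `hLSP`: for every
weighted graph (`prodBernoulli u` on `Fin n`), relays `A`, champion `q ∈ A`, relay `c ∈ A`, level `j` and nonempty finite set `B`
of non-relay vertices, `μ(q ≁ B, 1 ≤ |π(B)| ≤ j) + μ(|π(B)| = 0, |π(c)| ≤ j) ≤ μ(q ≁ B, |π(q)| ≤ j)` (reachability
`(openGraph ξ).Reachable`, definitionally `ξ ∈ openConn`).  Conclusion: the registered stub `stub_attachedChampion` verbatim.
[cite: VandenbergHaggstromKahn2005, Thm. 1.5 (p. 7); KozmaNitzan2024, Lemma 5 (p. 13)] -/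
theorem attachedChampion_of_lightStarPacking
    (hLSP : ∀ (n : ℕ) (u : Sym2 (Fin n) → unitInterval) (A B : Finset (Fin n)) (q c : Fin n) (j : ℕ),
      q ∈ A → c ∈ A → B.Nonempty → (∀ y ∈ B, y ∉ A) →
      (∀ a ∈ A, (prodBernoulli u).real {ξ : BondConfig (Fin n) | (A.filter fun z => (openGraph ξ).Reachable a z).card ≤ j} ≤
        (prodBernoulli u).real {ξ : BondConfig (Fin n) | (A.filter fun z => (openGraph ξ).Reachable q z).card ≤ j}) →
      (prodBernoulli u).real {ξ : BondConfig (Fin n) |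
          (∀ y ∈ B, ¬ (openGraph ξ).Reachable q y) ∧
            1 ≤ (A.filter fun z => ∃ y ∈ B, (openGraph ξ).Reachable y z).card ∧
            (A.filter fun z => ∃ y ∈ B, (openGraph ξ).Reachable y z).card ≤ j} +
        (prodBernoulli u).real {ξ : BondConfig (Fin n) |
          ¬ 1 ≤ (A.filter fun z => ∃ y ∈ B, (openGraph ξ).Reachable y z).card ∧
            (A.filter fun z => (openGraph ξ).Reachable c z).card ≤ j} ≤
      (prodBernoulli u).real {ξ : BondConfig (Fin n) |
          (∀ y ∈ B, ¬ (openGraph ξ).Reachable q y) ∧ (A.filter fun z => (openGraph ξ).Reachable q z).card ≤ j})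
    (n : ℕ) (w : Sym2 (Fin n) → unitInterval) (A : Finset (Fin n)) (o q : Fin n) (j : ℕ) (ho : o ∉ A) (hq : q ∈ A)
    (hchamp : ∀ a ∈ A,
      (prodBernoulli w).real {ω : BondConfig (Fin n) | (A.filter fun x => ω ∈ openConn a x).card ≤ j} ≤
        (prodBernoulli w).real {ω : BondConfig (Fin n) | (A.filter fun x => ω ∈ openConn q x).card ≤ j}) :
    (prodBernoulli w).real {ω : BondConfig (Fin n) |
        1 ≤ (A.filter fun x => ω ∈ openConn o x).card ∧ (A.filter fun x => ω ∈ openConn o x).card ≤ j} ≤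
      (prodBernoulli w).real {ω : BondConfig (Fin n) |
        (A.filter fun x => ω ∈ openConn q x).card ≤ j ∧ 1 ≤ (A.filter fun x => ω ∈ openConn o x).card} := by
  haveI : IsProbabilityMeasure (prodBernoulli w) := inferInstance
  set μ := prodBernoulli w with hμ
  set sW : Fin n → ℝ := fun y => μ.real {ω : BondConfig (Fin n) |
    (A.filter fun z => (openGraph (ω ∩ {e | o ∉ e})).Reachable y z).card ≤ j} with hsW
  -- the weights with the observer's pairs switched off, and the transfer of `K`-events
  set u : Sym2 (Fin n) → unitInterval := fun e => if e ∈ {e : Sym2 (Fin n) | o ∉ e} then w e else 0 with hu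
  have e1 : ∀ x : Fin n, {ω : BondConfig (Fin n) |
        (A.filter fun z => (openGraph (ω ∩ {e | o ∉ e})).Reachable x z).card ≤ j} =
      {ω : BondConfig (Fin n) | ω ∩ {e | o ∉ e} ∈
        {ξ : BondConfig (Fin n) | (A.filter fun z => (openGraph ξ).Reachable x z).card ≤ j}} := fun x => rfl
  -- a champion `p` of `K = G − o`
  obtain ⟨p, hpA, hpmax⟩ := Finset.exists_max_image A sW ⟨q, hq⟩
  have hchampK : ∀ a ∈ A,
      (prodBernoulli u).real {ξ : BondConfig (Fin n) | (A.filter fun z => (openGraph ξ).Reachable a z).card ≤ j} ≤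
        (prodBernoulli u).real {ξ : BondConfig (Fin n) | (A.filter fun z => (openGraph ξ).Reachable p z).card ≤ j} := by
    intro a ha
    have h := hpmax a ha
    simp only [hsW] at h
    rw [e1 a, e1 p, measureReal_preimage_avoid, measureReal_preimage_avoid] at h
    exact h
  refine tform_of_starPacking w A o p q j ho hpA hq ?_ (hpmax q hq) (hchamp p hpA)
  -- ### the star-packing inequality for every nonempty star
  intro B hBne hB
  -- rewrite the three `K`-events as preimages and transfer to `prodBernoulli u`
  have eP1 : {ω : BondConfig (Fin n) |
        (∀ y ∈ B, ¬ (openGraph (ω ∩ {e | o ∉ e})).Reachable p y) ∧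
          1 ≤ (A.filter fun z => ∃ y ∈ B, (openGraph (ω ∩ {e | o ∉ e})).Reachable y z).card ∧
          (A.filter fun z => ∃ y ∈ B, (openGraph (ω ∩ {e | o ∉ e})).Reachable y z).card ≤ j} =
      {ω : BondConfig (Fin n) | ω ∩ {e | o ∉ e} ∈ {ξ : BondConfig (Fin n) |
        (∀ y ∈ B, ¬ (openGraph ξ).Reachable p y) ∧
          1 ≤ (A.filter fun z => ∃ y ∈ B, (openGraph ξ).Reachable y z).card ∧
          (A.filter fun z => ∃ y ∈ B, (openGraph ξ).Reachable y z).card ≤ j}} := rfl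
  have eP2 : {ω : BondConfig (Fin n) |
        ¬ 1 ≤ (A.filter fun z => ∃ y ∈ B, (openGraph (ω ∩ {e | o ∉ e})).Reachable y z).card ∧
          (A.filter fun z => (openGraph (ω ∩ {e | o ∉ e})).Reachable q z).card ≤ j} =
      {ω : BondConfig (Fin n) | ω ∩ {e | o ∉ e} ∈ {ξ : BondConfig (Fin n) |
        ¬ 1 ≤ (A.filter fun z => ∃ y ∈ B, (openGraph ξ).Reachable y z).card ∧
          (A.filter fun z => (openGraph ξ).Reachable q z).card ≤ j}} := rfl
  have eP3 : {ω : BondConfig (Fin n) |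
        (∀ y ∈ B, ¬ (openGraph (ω ∩ {e | o ∉ e})).Reachable p y) ∧
          (A.filter fun z => (openGraph (ω ∩ {e | o ∉ e})).Reachable p z).card ≤ j} =
      {ω : BondConfig (Fin n) | ω ∩ {e | o ∉ e} ∈ {ξ : BondConfig (Fin n) |
        (∀ y ∈ B, ¬ (openGraph ξ).Reachable p y) ∧
          (A.filter fun z => (openGraph ξ).Reachable p z).card ≤ j}} := rfl
  rw [eP1, eP2, eP3, measureReal_preimage_avoid, measureReal_preimage_avoid, measureReal_preimage_avoid]
  set ν := prodBernoulli u with hν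
  haveI : IsProbabilityMeasure ν := inferInstance
  by_cases hrel : ∃ y ∈ B, y ∈ A
  · -- #### a star with a relay member: `|π(B)| ≥ 1` always, and unguarded stability
    obtain ⟨y, hyB, hyA⟩ := hrel
    have hM1 : ∀ ξ : BondConfig (Fin n), 1 ≤ (A.filter fun z => ∃ x ∈ B, (openGraph ξ).Reachable x z).card :=
      fun ξ => Finset.card_pos.2 ⟨y, Finset.mem_filter.2 ⟨hyA, y, hyB, SimpleGraph.Reachable.refl y⟩⟩
    have h2 : ν.real {ξ : BondConfig (Fin n) |
        ¬ 1 ≤ (A.filter fun z => ∃ y ∈ B, (openGraph ξ).Reachable y z).card ∧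
          (A.filter fun z => (openGraph ξ).Reachable q z).card ≤ j} = 0 := by
      have hempty : {ξ : BondConfig (Fin n) |
          ¬ 1 ≤ (A.filter fun z => ∃ y ∈ B, (openGraph ξ).Reachable y z).card ∧
            (A.filter fun z => (openGraph ξ).Reachable q z).card ≤ j} = ∅ := by
        ext ξ
        simp only [mem_setOf_eq, mem_empty_iff_false, iff_false, not_and]
        intro h
        exact absurd (hM1 ξ) h
      rw [hempty, measureReal_empty]
    rw [h2, add_zero]
    by_cases hpB : p ∈ B
    · refine measureReal_mono (fun ξ hξ => ?_) (measure_ne_top _ _)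
      exact absurd (SimpleGraph.Reachable.refl p) (hξ.1 p hpB)
    have hpy : p ≠ y := fun h => hpB (h ▸ hyB)
    have key := unguardedStability_of_member u A B hyB hpy j (hchampK y hyA)
    refine le_trans (measureReal_mono (fun ξ hξ => ?_) (measure_ne_top _ _)) key
    exact ⟨hξ.1, hξ.2.2⟩
  · -- #### an all-non-relay star: light-star packing in `K`
    push Not at hrel
    exact hLSP n u A B p q j hpA hq hBne hrel hchampK

/-- **LIGHT-STAR PACKING closes the crux `NoHeavyLowerTail`** (route `PercNearOneGluing` decl), through
`attachedChampion_of_lightStarPacking` and `Theorems.noHeavyLowerTail_of_attachedChampion`. -/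
theorem noHeavyLowerTail_of_lightStarPacking
    (hLSP : ∀ (n : ℕ) (u : Sym2 (Fin n) → unitInterval) (A B : Finset (Fin n)) (q c : Fin n) (j : ℕ),
      q ∈ A → c ∈ A → B.Nonempty → (∀ y ∈ B, y ∉ A) →
      (∀ a ∈ A, (prodBernoulli u).real {ξ : BondConfig (Fin n) | (A.filter fun z => (openGraph ξ).Reachable a z).card ≤ j} ≤
        (prodBernoulli u).real {ξ : BondConfig (Fin n) | (A.filter fun z => (openGraph ξ).Reachable q z).card ≤ j}) →
      (prodBernoulli u).real {ξ : BondConfig (Fin n) |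
          (∀ y ∈ B, ¬ (openGraph ξ).Reachable q y) ∧
            1 ≤ (A.filter fun z => ∃ y ∈ B, (openGraph ξ).Reachable y z).card ∧
            (A.filter fun z => ∃ y ∈ B, (openGraph ξ).Reachable y z).card ≤ j} +
        (prodBernoulli u).real {ξ : BondConfig (Fin n) |
          ¬ 1 ≤ (A.filter fun z => ∃ y ∈ B, (openGraph ξ).Reachable y z).card ∧
            (A.filter fun z => (openGraph ξ).Reachable c z).card ≤ j} ≤
      (prodBernoulli u).real {ξ : BondConfig (Fin n) |
          (∀ y ∈ B, ¬ (openGraph ξ).Reachable q y) ∧ (A.filter fun z => (openGraph ξ).Reachable q z).card ≤ j}) :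
    Summit.CriticalPhenomena.PercolationContinuityZ3.Theses.PercNearOneGluing.NoHeavyLowerTail :=
  noHeavyLowerTail_of_attachedChampion fun n w A o q j ho hq hchamp =>
    attachedChampion_of_lightStarPacking hLSP n w A o q j ho hq hchamp

end Summit.CriticalPhenomena.PercolationContinuityZ3.Theorems

end
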